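/-
Copyright (c) 2026 the pub-hodgecm-mathlib formalisation cell (harness21).  Prover seat hodgecm-mathlib-K2Liu-p01 (g6), Track B «K2-LIT»,
Road I organ (A-int)-fin, A2d-3 «geometric actions junction — the Weyl letter» (LEAD F0P6-plan (g12) 08:00:40Z).  KERNEL: theorems only.
-/
import Summits.HodgeConjecture.HodgeConjecture.Theorems.K2LiuDeltaSpTransportAdaptedBlocks     -- ★ A2d-2 p858595 (master formula; brings A2d-1, A2c, β-1)
import Literature.NumberTheory.GelbartRogawski1991.LocalDoubledWeylElementCayleyMover        -- ★ `matA_weylDelta`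
import HarnessLib

/-!
# Crux `HLiu418`, Track B road `K2_Liu`, Road I organ (A-int)-fin — A2d-3: THE WEYL LETTER `w_Δ` IN THE `ℓ_Δ`-ADAPTED COORDINATES IS WEIL's `d₀′` = THE SWAP
# `deltaCoords ∘ ι(w_Δ) ∘ deltaCoords⁻¹ = weylSp id id` (`(x, y) ↦ (y, x)`), and the junction with the Weyl operator `weylEquivSB` (= the `β_{J_Δ}`-Fourier transform)

Cell `hodgecm-mathlib`, crux item hLiu418 = `stmt-HodgeConjecture-24832`, route of record `HCCMUnconditional`; squad K2 ∕ K2Liu, prover K2Liu-p01 (g6).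
THEOREMS ONLY (no `def`, no instance, no notation, no named fact, no `sorry`); lane `--supports stmt-HodgeConjecture-24832 --as helper`.

★ `matA_weylDelta : matA w_Δ = (1, 0; 0, −1)` ⇒ adapted blocks `(A, B; C, D) = (0, 1; 1, 0)` (`w_Δ` exchanges `Δ` and `Δ⁻`), so the master formula of ★ A2d-2 reads
`σ′_{w_Δ} (R b, R a) = (R a, R b)`: in the doubling-polarised coordinates the Weyl element of the doubled group is THE SWAP of `X_Δ` and `Y_Δ` — Weil's `d₀′(γ)`
with `γ = δ = id` (legitimate because `β_{J_Δ}` is ANTISYMMETRIC: `J_Δᵀ = −J_Δ`).  Its implementers on `𝒮(X_Δ)` are the scalar multiples of the `β_{J_Δ}`-Fourier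
transform ★ `weylEquivSB` (implementer uniqueness, ★ A2c), which the ★ Fourier clause `K2LiuKudlaRallisMapFourier.krFun_betaFourier_eq` carries through `r_w`.
* §1 `deltaGram_transpose` (`J_Δᵀ = −J_Δ`), `toLinearMap₂'_deltaGram_swap` (`β(y, x) = −β(x, y)`), the adapted blocks of `w_Δ` (`blkA/B/C/D_matA_weylDelta`);
* §2 **`deltaTransport_iotaD_weylDelta_apply : σ′_{w_Δ} (R b, R a) = (R a, R b)`**, **`deltaTransport_iotaD_weylDelta_eq_weylSp : σ′_{w_Δ} = weylSp β_{J_Δ} id id _`**;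
* §3 the junction pin **`exists_toRep_eq_smul_weylEquivSB`** (any Schrödinger model with unique implementers; hypothesis-first in Weil's (i) stability ∕ (ii) inversion data
  `hW, c, hinv` of ★ `weylEquivSB`): a pair over `weylSp γ δ` acts by `c′ • weylEquivSB`.

HONEST LABEL: HC_CM is proved only modulo the printed citations (2 remaining named inputs: hLiu418 = stmt-HodgeConjecture-24832, h413 = stmt-HodgeConjecture-24833)
until rung 0 closes; helper, closes no item.
References: [Weil1964] n° 6 (`d₀′(γ)`), n° 13, n° 32; [Kudla1994] §3; [MoeglinVignerasWaldspurger1987] Chap. 2 I.7, II.1, II.6; [HarrisKudlaSweet1996] §1 (1.11).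
-/

set_option autoImplicit false
set_option linter.dupNamespace false -- the mandated namespace repeats `HodgeConjecture.HodgeConjecture`

noncomputable section

open Matrix Topology MeasureTheory
open NumberField IsDedekindDomain
open Literature.NumberTheory.Automorphic Literature.NumberTheory.Automorphic.UnitaryGroup
open Literature.NumberTheory.Automorphic.UnitaryGroup.QuadraticCoordinates
open Literature.RepresentationTheory.HeisenbergGroup
open Literature.NumberTheory.GelbartRogawski1991 Literature.NumberTheory.GelbartRogawski1991.AdaptedBlocks
open Literature.NumberTheory.GelbartRogawski1991.UnitaryDualPair.LocalSplitting
open Summit.HodgeConjecture.HodgeConjecture.Cruxes.HLiu418.K2LiuDeltaSpTransportSiegelLetters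
open Summit.HodgeConjecture.HodgeConjecture.Cruxes.HLiu418.K2LiuDeltaSpTransportAdaptedBlocks

namespace Summit.HodgeConjecture.HodgeConjecture.Cruxes.HLiu418.K2LiuDeltaSpTransportWeylLetter

universe u

/-! ## §1 `J_Δ` is antisymmetric; the adapted blocks of `w_Δ` -/

section Gram

variable {K : Type*} [CommRing K] {κ ι : Type*} [Fintype κ] [Fintype ι] [DecidableEq κ] [DecidableEq ι] (e : κ ⊕ κ ≃ ι) (T₀ : Matrix κ κ K)

omit [Fintype κ] [Fintype ι] [DecidableEq κ] [DecidableEq ι] in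
/-- **`J_Δᵀ = −J_Δ`** (`J_Δ = e (0, 2T₀; −2T₀ᵀ, 0) e`). [cite: Kudla1994, §2] -/
theorem deltaGram_transpose : (deltaGram e T₀)ᵀ = -deltaGram e T₀ := by
  ext i j
  obtain ⟨a, rfl⟩ := e.surjective i
  obtain ⟨b, rfl⟩ := e.surjective j
  simp only [deltaGram, Matrix.transpose_apply, Matrix.neg_apply, Matrix.reindex_apply, Matrix.submatrix_apply, Equiv.symm_apply_apply]
  rcases a with a | a <;> rcases b with b | b <;>
    simp [Matrix.fromBlocks_apply₁₁, Matrix.fromBlocks_apply₁₂, Matrix.fromBlocks_apply₂₁, Matrix.fromBlocks_apply₂₂, Matrix.transpose_apply]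

omit [Fintype κ] [DecidableEq κ] in
/-- **`β_{J_Δ}(y, x) = −β_{J_Δ}(x, y)`**. [cite: Kudla1994, §2] -/
theorem toLinearMap₂'_deltaGram_swap (x y : ι → K) :
    Matrix.toLinearMap₂' K (deltaGram e T₀) y x = -Matrix.toLinearMap₂' K (deltaGram e T₀) x y := by
  rw [Matrix.toLinearMap₂'_apply', Matrix.toLinearMap₂'_apply', dotProduct_comm, ← Matrix.vecMul_transpose, deltaGram_transpose,
    Matrix.vecMul_neg, neg_dotProduct, Matrix.dotProduct_mulVec]

end Gram

section Letter

variable (F : Type) [Field F] [NumberField F] (E : Type) [Field E] [NumberField E] [Algebra F E]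
  [Algebra.IsQuadraticExtension F E] (c : E ≃ₐ[F] E)
  {δ : E} (hcδ : c δ = -δ) (hδ : δ ≠ 0) {d : F} (hd : δ * δ = algebraMap F E d)
  (v : HeightOneSpectrum (𝓞 F)) (n : ℕ) {T₀ : Matrix (Fin n) (Fin n) F} (hT₀ : T₀.IsSymm) (hT₀d : IsUnit T₀.det)
  {JD : Matrix (Fin (n + n)) (Fin (n + n)) E} (hJD : JD = (gramD F n T₀).map (algebraMap F E))

omit [Algebra.IsQuadraticExtension F E] in
/-- **the adapted blocks of the Weyl element are `(0, 1; 1, 0)`**: `w_Δ` swaps `Δ` and `Δ⁻` (★ `matA_weylDelta = (1, 0; 0, −1)`). [cite: Kudla1994, §3] -/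
theorem blocks_matA_weylDelta :
    blkA (matA F E c v n (weylDelta F E c v n hJD (T₀ := T₀))) = 0 ∧ blkB (matA F E c v n (weylDelta F E c v n hJD (T₀ := T₀))) = 1 ∧
      blkC (matA F E c v n (weylDelta F E c v n hJD (T₀ := T₀))) = 1 ∧ blkD (matA F E c v n (weylDelta F E c v n hJD (T₀ := T₀))) = 0 := by
  have h2 : ⅟(2 : LocalRing E v) • ((1 : Matrix (Fin n) (Fin n) (LocalRing E v)) + 1) = 1 := by
    rw [← two_smul (LocalRing E v) (1 : Matrix (Fin n) (Fin n) (LocalRing E v)), smul_smul, invOf_mul_self, one_smul]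
  rw [matA_weylDelta]
  simp only [blkA, blkB, blkC, blkD, Matrix.toBlocks_fromBlocks₁₁, Matrix.toBlocks_fromBlocks₁₂, Matrix.toBlocks_fromBlocks₂₁, Matrix.toBlocks_fromBlocks₂₂,
    add_zero, sub_zero, add_neg_cancel, smul_zero, sub_neg_eq_add, h2, and_self]

/-! ## §2 The Weyl letter is the swap -/

include hT₀ hJD in
/-- **`σ′_{w_Δ} (R b, R a) = (R a, R b)`** — the master formula of ★ A2d-2 at `w_Δ`. [cite: Kudla1994, §3] [cite: Weil1964, n° 32] -/
theorem deltaTransport_iotaD_weylDelta_apply (a b : Fin n → LocalRing E v) :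
    ((deltaSymplecticTransport (e₂ n) (T₀.map (algebraMap F (v.adicCompletion F))) (localGram_gramD F v n (T₀ := T₀))
        (iotaD F E c hcδ hδ hd v n hT₀ hJD (weylDelta F E c v n hJD)) :
        symplecticGroup (polar (Matrix.toLinearMap₂' (v.adicCompletion F) (deltaGram (e₂ n) (T₀.map (algebraMap F (v.adicCompletion F))))))) :
        ((Fin (n + n) → v.adicCompletion F) × (Fin (n + n) → v.adicCompletion F)) ≃ₗ[v.adicCompletion F]
          ((Fin (n + n) → v.adicCompletion F) × (Fin (n + n) → v.adicCompletion F)))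
      (glue (e₂ n) (fun i => re (quadraticLocalEquiv E v c hcδ hδ).toLinearEquiv.toAddEquiv (b i))
          (fun i => im (quadraticLocalEquiv E v c hcδ hδ).toLinearEquiv.toAddEquiv (b i)),
        glue (e₂ n) (fun i => re (quadraticLocalEquiv E v c hcδ hδ).toLinearEquiv.toAddEquiv (a i))
          (fun i => im (quadraticLocalEquiv E v c hcδ hδ).toLinearEquiv.toAddEquiv (a i))) =
      (glue (e₂ n) (fun i => re (quadraticLocalEquiv E v c hcδ hδ).toLinearEquiv.toAddEquiv (a i))
          (fun i => im (quadraticLocalEquiv E v c hcδ hδ).toLinearEquiv.toAddEquiv (a i)),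
        glue (e₂ n) (fun i => re (quadraticLocalEquiv E v c hcδ hδ).toLinearEquiv.toAddEquiv (b i))
          (fun i => im (quadraticLocalEquiv E v c hcδ hδ).toLinearEquiv.toAddEquiv (b i))) := by
  obtain ⟨hA, hB, hC, hD⟩ := blocks_matA_weylDelta F E c v n (T₀ := T₀) hJD
  have h := deltaTransport_iotaD_apply F E c hcδ hδ hd v n hT₀ hJD (weylDelta F E c v n hJD) a b
  simp only [hA, hB, hC, hD, Matrix.zero_mulVec, Matrix.one_mulVec, zero_add, add_zero] at h
  exact h

include hT₀ hJD in
/-- **THE WEYL LETTER IS THE SWAP**: `deltaCoords ∘ ι(w_Δ) ∘ deltaCoords⁻¹ = weylSp β_{J_Δ} id id` (`(x, y) ↦ (y, x)`; Weil's `d₀′(γ)` with `γ = δ = id`, admissible since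
`β_{J_Δ}(y, x) = −β_{J_Δ}(x, y)`).
[cite: Weil1964, n° 6, n° 32] [cite: Kudla1994, §3] [cite: MoeglinVignerasWaldspurger1987, Chap. 2 I.7] -/
theorem deltaTransport_iotaD_weylDelta_eq_weylSp :
    deltaSymplecticTransport (e₂ n) (T₀.map (algebraMap F (v.adicCompletion F))) (localGram_gramD F v n (T₀ := T₀))
        (iotaD F E c hcδ hδ hd v n hT₀ hJD (weylDelta F E c v n hJD)) =
      weylSp (Matrix.toLinearMap₂' (v.adicCompletion F) (deltaGram (e₂ n) (T₀.map (algebraMap F (v.adicCompletion F)))))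
        (LinearEquiv.refl (v.adicCompletion F) _) (LinearEquiv.refl (v.adicCompletion F) _)
        (fun x y => toLinearMap₂'_deltaGram_swap (e₂ n) (T₀.map (algebraMap F (v.adicCompletion F))) x y) := by
  apply Subtype.ext
  refine LinearEquiv.ext fun w => ?_
  obtain ⟨x, y⟩ := w
  obtain ⟨bb, rfl⟩ := exists_eq_glue_re_im F E c hcδ hδ v n x
  obtain ⟨aa, rfl⟩ := exists_eq_glue_re_im F E c hcδ hδ v n y
  rw [coe_weylSp, weylσ_apply]
  exact deltaTransport_iotaD_weylDelta_apply F E c hcδ hδ hd v n hT₀ hJD aa bb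

end Letter

/-! ## §3 The junction pin for a Weyl pair -/

section Junction

variable {R : Type u} [CommRing R] [Invertible (2 : R)] {X : Type*} {Y : Type*} [AddCommGroup X] [Module R X]
  [AddCommGroup Y] [Module R Y] (β : X →ₗ[R] Y →ₗ[R] R) (ψ : AddChar R Circle)
  [TopologicalSpace X] [TopologicalSpace R] [IsTopologicalAddGroup X]
  [MeasurableSpace X] (μ : Measure X) [OpensMeasurableSpace X] [IsFiniteMeasureOnCompacts μ] [MeasurableAdd X] [μ.IsAddRightInvariant]
  (hψ : IsLocallyConstant (⇑ψ : R → Circle)) (hβ : ∀ y : Y, Continuous fun u : X => β u y)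

/-- **A PAIR OVER A WEYL ELEMENT ACTS BY A SCALAR MULTIPLE OF WEIL's `d₀′(γ)` = THE `β`-FOURIER TRANSFORM**: with Weil's data (i) stability `hW` and (ii) inversion
`hinv` of ★ `weylEquivSB` (theorems at a finite place: ★ `piFourierSB_mem_schwartzBruhat`, ★ `piFourierSB_piFourierSB_eq`), a pair `p` over `weylSp γ δ` satisfies
`toRep p = c′ • weylEquivSB` (implementer uniqueness). [cite: MoeglinVignerasWaldspurger1987, Chap. 2 II.1 (A), II.6] [cite: Weil1964, n° 13] -/
theorem exists_toRep_eq_smul_weylEquivSB (hU : ImplementerUniqueUpToScalar (schrodingerSB β ψ hψ hβ))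
    (γ : Y ≃ₗ[R] X) (δ : X ≃ₗ[R] Y) (hγδ : ∀ (x : X) (y : Y), β (γ y) (δ x) = -β x y)
    (hW : ∀ f : SchwartzBruhat X, weylFun β ψ μ γ f ∈ SchwartzBruhat X) (c : ℂˣ)
    (hinv : ∀ f : SchwartzBruhat X, weylFun β ψ μ γ (weylFun β ψ μ γ f) = (c : ℂ) • fun u => (f : X → ℂ) (-u))
    (p : MpPsi (schrodingerSB β ψ hψ hβ)) (hp : MpPsi.proj (schrodingerSB β ψ hψ hβ) p = weylSp β γ δ hγδ) :
    ∃ c' : ℂˣ, ∀ f : SchwartzBruhat X, MpPsi.toRep (schrodingerSB β ψ hψ hβ) p f = (c' : ℂ) • weylEquivSB β ψ μ γ hψ hβ hW c hinv f := by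
  have hM : Implements (schrodingerSB β ψ hψ hβ) (ofSymplectic _ (weylSp β γ δ hγδ)) (weylEquivSB β ψ μ γ hψ hβ hW c hinv) :=
    (mem_MpPsi _ _).1 (weyl_mem_MpPsi β ψ μ hψ hβ γ δ hγδ hW c hinv)
  have hM' : Implements (schrodingerSB β ψ hψ hβ) (ofSymplectic _ (weylSp β γ δ hγδ)) (MpPsi.toOp (schrodingerSB β ψ hψ hβ) p) := by
    have h := MpPsi.toRep_implements (schrodingerSB β ψ hψ hβ) p
    rwa [← MpPsi.proj_apply, hp] at h
  obtain ⟨c', hc'⟩ := hU _ _ _ hM hM'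
  exact ⟨c', fun f => hc' f⟩

end Junction

end Summit.HodgeConjecture.HodgeConjecture.Cruxes.HLiu418.K2LiuDeltaSpTransportWeylLetter

end
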